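import Literature.AnabelianGeometry.SemiGraphs.AmbientVocabReal
import Literature.AnabelianGeometry.SemiGraphs.OneVertexWitness
import Literature.AnabelianGeometry.SemiGraphs.ArithSemiGraphNonVacuity
import Literature.AnabelianGeometry.Anabelioids.GaloisEquivalence
import Literature.AnabelianGeometry.Anabelioids.FiberFunctorUnique
import Mathlib.CategoryTheory.Galois.Examples
import HarnessLib

/-!
# Non-vacuity of the one-universe ambient category `SgA.{u,u,u}` and of `SemiAnbdVocab.real` (proof-only + witnesses)

Mochizuki, *Semi-graphs of anabelioids*, Publ. RIMS **42** (2006), Rmk 2.4.2 p. 26 (the ambient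
category of totally aloof, verticially slim semi-graphs of anabelioids), §0 p. 6 / [GeoAn] §1.1
(connected anabelioids = Galois categories, e.g. `B(1)` = finite sets) (kurims `paper:url-f33ace170ff4`).
[cite: MochizukiSemiAnbd2006, Rmk 2.4.2, p. 26]

HONEST-SCOPE companion of `AmbientVocabReal.lean` (abc-iut-L3-t3 gen 5): the parameter-free container
`SemiAnbdVocab.real` lives over the ONE-UNIVERSE ambient category `SgA.{u,u,u}` (constituent Galois
categories `C : Type u` with `Category.{u} C`, forced by gen 4's `ofRealOfTempered`).  The tree's
semi-graphs of anabelioids built from `B(Π)` (`BCat Π : Type (u+1)`, `toAnab`) live in `SgA.{u,u+1,u}`,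
so until now NO object of `SgA.{u,u,u}` with a vertex was in the tree.  This file supplies one:

* `galoisCategory_fintypeCat` / `galoisCategory_fintypeCatSkeleton` — finite sets (`= B(1)`, Mathlib's
  `Action FintypeCat PUnit` along `Action.actionPUnitEquivalence`) and their `u`-SMALL skeleton
  `FintypeCat.Skeleton.{u} : Type u` (Mathlib) are Galois categories (abc-iut `galoisCategory_of_equivalence`);
* `fiberFunctor_skeletonIncl`, `subsingleton_aut_skeletonIncl`, `isSlim_fintypeCatSkeleton` —
  `π₁(B(1)) = 1` at the basepoint `Skeleton.incl`, so `B(1)` is slim (vacuously: every subgroup of the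
  trivial group is `⊥`);
* `ptSgA` — the semi-graph of anabelioids with ONE vertex carrying `B(1)` (as `FintypeCat.Skeleton`)
  and no edges (underlying semi-graph = abc-iut-L3-t2's `OneVertex.ptSemiGraph`), an object
  `ptSgAObj : SgA.{u,u,u}` (totally aloof and every-edge-abuts vacuously, verticially slim by the above);
* non-vacuity at the REAL container: `SgA.exists_nonempty_vertex`, `SemiAnbdVocab.real_isConnected_ptSgAObj`,
  `SemiAnbdVocab.real_isFinite_ptSgAObj`, `SemiAnbdVocab.real_exists_isConnected_and_isFinite`.

Nothing of the paper is asserted; no side taken on [IUTchIII] Cor. 3.12.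
-/

noncomputable section

namespace Literature.AnabelianGeometry.SemiGraphs

open CategoryTheory CategoryTheory.Limits CategoryTheory.PreGaloisCategory
open Literature.AnabelianGeometry.Anabelioids
open Literature.AlgebraicGeometry.Frobenioids (IsSlimGroup)

universe u

/-! ### `B(1)`: finite sets and their small skeleton are Galois categories -/

/-- **Finite sets form a Galois category** (`B(1)`; [GeoAn] §1.1 p.9 "`B(G)` … a Galois category"
at `G = 1`): Mathlib's `GaloisCategory (Action FintypeCat PUnit)` transported along
`Action.actionPUnitEquivalence : Action FintypeCat PUnit ≌ FintypeCat`. [cite: MochizukiGeoAn2004, §1.1 p.9] -/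
theorem galoisCategory_fintypeCat : GaloisCategory FintypeCat.{u} :=
  galoisCategory_of_equivalence
    (Action.actionPUnitEquivalence (V := FintypeCat.{u}) : Action FintypeCat.{u} PUnit.{u + 1} ≌ _)

/-- **The `u`-small skeleton of finite sets is a Galois category** in ONE universe
(`FintypeCat.Skeleton.{u} : Type u`, `Category.{u}`), along Mathlib's `Skeleton.equivalence`.
[cite: MochizukiGeoAn2004, §1.1 p.9] -/
theorem galoisCategory_fintypeCatSkeleton : GaloisCategory FintypeCat.Skeleton.{u} := by
  letI := galoisCategory_fintypeCat.{u}
  exact galoisCategory_of_equivalence FintypeCat.Skeleton.equivalence.symm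

/-- The inclusion `Skeleton ⥤ FintypeCat` (an equivalence) is a fibre functor of the Galois category
`FintypeCat.Skeleton` (equivalences preserve all finite (co)limits and reflect isomorphisms).
[cite: MochizukiGeoAn2004, §1.1 p.9] -/
theorem fiberFunctor_skeletonIncl :
    letI := galoisCategory_fintypeCatSkeleton.{u}
    FiberFunctor FintypeCat.Skeleton.incl.{u} := by
  letI := galoisCategory_fintypeCatSkeleton.{u}
  exact
    { preservesTerminalObjects := inferInstance
      preservesPullbacks := inferInstance
      preservesFiniteCoproducts := ⟨fun _ => inferInstance⟩
      preservesEpis := inferInstance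
      preservesQuotientsByFiniteGroups := fun _ _ _ => inferInstance
      reflectsIsos := inferInstance }

/-- **`π₁(B(1)) = 1`**: every automorphism of the basepoint `Skeleton.incl` is the identity
(naturality against the constant maps from the one-point set pins every point).
[cite: MochizukiGeoAn2004, §1.1 p.10] -/
theorem subsingleton_aut_skeletonIncl : Subsingleton (Aut FintypeCat.Skeleton.incl.{u}) := by
  refine ⟨fun σ τ => ?_⟩
  suffices h : ∀ ρ : Aut FintypeCat.Skeleton.incl.{u}, ρ = 1 by rw [h σ, h τ]
  intro ρ
  refine Iso.ext (NatTrans.ext (funext fun X => ?_))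
  ext x
  -- the constant map `c_x : [1] → X` at `x`, and the unique point of `[1]`
  let one : FintypeCat.Skeleton.{u} := FintypeCat.Skeleton.mk 1
  let pt : FintypeCat.Skeleton.incl.obj one := ⟨(0 : Fin 1)⟩
  let c : one ⟶ X := fun _ => x
  have hnat := NatTrans.naturality_apply ρ.hom c pt
  -- `ρ_one` fixes the unique point of `[1]`
  haveI : Subsingleton (FintypeCat.Skeleton.incl.obj one) :=
    (inferInstance : Subsingleton (ULift (Fin 1)))
  have h1 : (ρ.hom.app one) pt = pt := Subsingleton.elim _ _
  rw [h1] at hnat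
  exact hnat

/-- **`B(1)` (as `FintypeCat.Skeleton`) is slim**: its fundamental group is trivial, so every
centraliser is `⊥` (`IsSlim` via `isSlim_iff_isSlimGroup_aut` at the basepoint `Skeleton.incl`).
[cite: MochizukiSemiAnbd2006, §0, p. 6] -/
theorem isSlim_fintypeCatSkeleton :
    letI := galoisCategory_fintypeCatSkeleton.{u}
    Anabelioids.IsSlim FintypeCat.Skeleton.{u} := by
  letI := galoisCategory_fintypeCatSkeleton.{u}
  haveI := fiberFunctor_skeletonIncl.{u}
  haveI := subsingleton_aut_skeletonIncl.{u}
  rw [isSlim_iff_isSlimGroup_aut FintypeCat.Skeleton.incl.{u}]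
  exact ⟨fun H _ => Subsingleton.elim _ _⟩

/-! ### A one-vertex object of `SgA.{u,u,u}` -/

/-- **The semi-graph of anabelioids with one vertex carrying `B(1)` and no edges**, in ONE universe:
underlying semi-graph abc-iut-L3-t2's `OneVertex.ptSemiGraph`, vertex constituent the small Galois
category `FintypeCat.Skeleton.{u}`. [cite: MochizukiSemiAnbd2006, Def. 2.1 p.22] -/
def ptSgA : SemiGraphOfAnabelioids.{u, u, u} where
  graph := ProfiniteSemiGraph.OneVertex.ptSemiGraph.{u}
  V _ := FintypeCat.Skeleton.{u}
  galV _ := galoisCategory_fintypeCatSkeleton.{u}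
  E e := nomatch e
  catE e := nomatch e
  galE e := nomatch e
  pull b := nomatch b

/-- `ptSgA` has a vertex. [cite: MochizukiSemiAnbd2006, Def. 2.1 p.22] -/
theorem ptSgA_nonempty_vertex : Nonempty ptSgA.{u}.graph.Vertex := ⟨PUnit.unit⟩

/-- `ptSgA` has no edges. [cite: MochizukiSemiAnbd2006, Def. 2.1 p.22] -/
theorem ptSgA_isEmpty_edge : IsEmpty ptSgA.{u}.graph.Edge := ⟨fun e => nomatch e⟩

/-- `ptSgA` is totally aloof (there is no edge). [cite: MochizukiSemiAnbd2006, Def. 2.4(iv) p.26] -/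
theorem ptSgA_isTotallyAloof : ptSgA.{u}.IsTotallyAloof := ⟨fun e => nomatch e⟩

/-- `ptSgA` is verticially slim (`B(1)` is slim). [cite: MochizukiSemiAnbd2006, Def. 2.4(ii) p.25] -/
theorem ptSgA_isVerticiallySlim : ptSgA.{u}.IsVerticiallySlim := ⟨fun _ => isSlim_fintypeCatSkeleton⟩

/-- Every edge of `ptSgA` abuts to a vertex (there is no edge). [cite: MochizukiSemiAnbd2006, Rem. 2.4.2 p.26] -/
theorem ptSgA_everyEdgeAbuts : ptSgA.{u}.EveryEdgeAbuts := fun e => nomatch e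

/-- **An object of the one-universe ambient category `SgA.{u,u,u}` with a vertex.**
[cite: MochizukiSemiAnbd2006, Rmk 2.4.2, p. 26] -/
def ptSgAObj : SgAQuot.SgA.{u, u, u} :=
  ⟨⟨SgAQuot.mk ptSgA.{u}⟩, ptSgA_isTotallyAloof, ptSgA_isVerticiallySlim, ptSgA_everyEdgeAbuts⟩

/-- The underlying semi-graph of anabelioids of `ptSgAObj` is `ptSgA`. [cite: MochizukiSemiAnbd2006, Rmk 2.4.2, p. 26] -/
@[simp] theorem ptSgAObj_toSgA : ptSgAObj.{u}.toSgA = ptSgA.{u} := rfl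

namespace SgAQuot.SgA

/-- **`SgA.{u,u,u}` has an object with a vertex** (so the statements of `AmbientVocabOfRealOut.lean`,
`AmbientVocabReal.lean`, `ArithmeticDef51CondCClosures.def51CondC_both_ways` … over one-universe objects
are not about an empty type). [cite: MochizukiSemiAnbd2006, Rmk 2.4.2, p. 26] -/
theorem exists_nonempty_vertex : ∃ G : SgA.{u, u, u}, Nonempty G.toSgA.graph.Vertex :=
  ⟨ptSgAObj, ptSgA_nonempty_vertex⟩

end SgAQuot.SgA

/-! ### At `SemiAnbdVocab.real` -/

/-- `ptSgAObj` is CONNECTED for the parameter-free container (one vertex, no edges;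
abc-iut-w6-d117's `SemiAnbdVocab.isConnected_of_unique_of_isEmpty`).
[cite: MochizukiSemiAnbd2006, §2, p. 22] -/
theorem SemiAnbdVocab.real_isConnected_ptSgAObj : SemiAnbdVocab.real.{u}.IsConnected ptSgAObj.{u} := by
  haveI : Unique (SemiAnbdVocab.real.{u}.Vert ptSgAObj.{u}) :=
    (inferInstance : Unique PUnit.{u + 1})
  haveI : IsEmpty (SemiAnbdVocab.real.{u}.Edge ptSgAObj.{u}) := ptSgA_isEmpty_edge
  exact SemiAnbdVocab.isConnected_of_unique_of_isEmpty _ _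

/-- `ptSgAObj` is FINITE for the parameter-free container. [cite: MochizukiSemiAnbd2006, §1, p. 11] -/
theorem SemiAnbdVocab.real_isFinite_ptSgAObj : SemiAnbdVocab.real.{u}.IsFinite ptSgAObj.{u} :=
  ⟨(inferInstance : Finite PUnit.{u + 1}), (inferInstance : Finite PEmpty.{u + 1})⟩

/-- **Non-vacuity of `SemiAnbdVocab.real`**: the parameter-free §§4–5 container has a finite connected
object with a vertex. [cite: MochizukiSemiAnbd2006, Rmk 2.4.2, p. 26] -/
theorem SemiAnbdVocab.real_exists_isConnected_and_isFinite :
    ∃ G : SgAQuot.SgA.{u, u, u}, Nonempty (SemiAnbdVocab.real.{u}.Vert G) ∧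
      SemiAnbdVocab.real.{u}.IsConnected G ∧ SemiAnbdVocab.real.{u}.IsFinite G :=
  ⟨ptSgAObj, ptSgA_nonempty_vertex, SemiAnbdVocab.real_isConnected_ptSgAObj,
    SemiAnbdVocab.real_isFinite_ptSgAObj⟩

end Literature.AnabelianGeometry.SemiGraphs

end
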